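import Summits.SmoothPoincare4.SmoothPoincare4.Theses.EntropyRung
import Summits.SmoothPoincare4.SmoothPoincare4.Theorems.EntropyRungSubcylindricalExistenceRoundClauseEuclidean
import Literature.Geometry.Riemannian.RoundSphereProofs
import Literature.Geometry.Riemannian.AubinYamabeSphereEuclidean
import Literature.Topology.FourManifolds.PalaisBallComplement
import HarnessLib

/-!
# Mathlib's stereographic chart of `S⁴ ⊂ ℝ⁵` at a point `p`
(witness helper 1 `helper_sphereChart` of the `S⁴` witness of the transfer stub of line
`green-blowup-conformal-entropy`, crux `EntropyRung.SubcylindricalExistence`,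
item stmt-SmoothPoincare4-10871)

For `p` on Mathlib's unit sphere `S⁴ = Metric.sphere (0 : EuclideanSpace ℝ (Fin 5)) 1` the preferred
chart is `chartAt p = stereographic' 4 (-p)` (stereographic projection from the antipode `-p`,
followed by a linear isometry `(-p)ᗮ ≃ ℝ⁴`), and `extChartAt (𝓡 4) p` is the same map read through
the trivial model with corners `𝓡 4 = 𝓘(ℝ, ℝ⁴)`. We record the four facts the witness uses:

* `extChartAt (𝓡 4) p p = 0` (`σ_{-p}⁻¹ 0 = p`, `stereographic'_symm_zero` of
  `PalaisBallComplement.lean`, and `right_inv`);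
* `(extChartAt (𝓡 4) p).target = univ` (`RoundClauseEuclidean.extChartAt_target_sphere`);
* `x ≠ -p → x ∈ (extChartAt (𝓡 4) p).source` (`stereographic'_source = {pole}ᶜ`);
* `⟪(extChartAt (𝓡 4) p)⁻¹ y, p⟫ = (4 − ‖y‖²)/(4 + ‖y‖²)` — the height of the inverse
  stereographic projection in Mathlib's normalisation
  `σᵥ⁻¹(y) = (‖y‖² + 4)⁻¹ (4 y' + (‖y‖² − 4) v)`, `y' ⊥ v`, at the pole `v = -p`
  (`real_inner_stereographic'_symm_pole` of `PalaisBallComplement.lean`).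

All folklore (Lee 2018, Ch. 3, stereographic coordinates); no definitions, no named facts.
-/

noncomputable section

-- the registered namespace `Summit.SmoothPoincare4.SmoothPoincare4.Theorems` repeats a component
set_option linter.dupNamespace false

open scoped Manifold ContDiff Topology ENNReal NNReal ContinuousMap RealInnerProductSpace
-- Mathlib's scoped instance `Fact (finrank ℝ (EuclideanSpace ℝ (Fin n)) = n)`, feeding the
-- `[Fact (finrank ℝ V = n + 1)]` hypotheses of the sphere API
open scoped EuclideanSpace
open Set Filter MeasureTheory
open Literature.Geometry.Lorentzian Literature.Geometry.Riemannian

namespace Summit.SmoothPoincare4.SmoothPoincare4.Theorems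

namespace SphereChart

/-- The inverse extended chart of `S⁴` at `p` is the inverse of Mathlib's `stereographic' 4 (-p)`
(the model with corners `𝓡 4` is the identity). [folklore] -/
theorem extChartAt_symm_eq (p : Metric.sphere (0 : EuclideanSpace ℝ (Fin 5)) 1)
    (y : EuclideanSpace ℝ (Fin 4)) :
    (extChartAt (𝓡 4) p).symm y = (stereographic' 4 (-p)).symm y := by
  rw [extChartAt_coe_symm, modelWithCornersSelf_coe_symm]
  rfl

/-- `(extChartAt (𝓡 4) p)⁻¹ 0 = p`: the antipode of the pole `-p` is sent to the origin.
[folklore] -/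
theorem extChartAt_symm_zero (p : Metric.sphere (0 : EuclideanSpace ℝ (Fin 5)) 1) :
    (extChartAt (𝓡 4) p).symm 0 = p := by
  rw [extChartAt_symm_eq, Literature.Topology.FourManifolds.stereographic'_symm_zero, neg_neg]

/-- `extChartAt (𝓡 4) p p = 0`. [folklore] -/
theorem extChartAt_self (p : Metric.sphere (0 : EuclideanSpace ℝ (Fin 5)) 1) :
    extChartAt (𝓡 4) p p = 0 := by
  have h0 : (0 : EuclideanSpace ℝ (Fin 4)) ∈ (extChartAt (𝓡 4) p).target := by
    rw [RoundClauseEuclidean.extChartAt_target_sphere]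
    exact mem_univ 0
  calc extChartAt (𝓡 4) p p = extChartAt (𝓡 4) p ((extChartAt (𝓡 4) p).symm 0) := by
        rw [extChartAt_symm_zero]
    _ = 0 := (extChartAt (𝓡 4) p).right_inv h0

/-- Every point but the pole `-p` lies in the domain of the chart at `p`. [folklore] -/
theorem mem_extChartAt_source_of_ne (p : Metric.sphere (0 : EuclideanSpace ℝ (Fin 5)) 1)
    {x : Metric.sphere (0 : EuclideanSpace ℝ (Fin 5)) 1} (hx : x ≠ -p) :
    x ∈ (extChartAt (𝓡 4) p).source := by
  rw [extChartAt_source]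
  change x ∈ (stereographic' 4 (-p)).source
  rw [stereographic'_source]
  exact hx

/-- **Height in the chart**: `⟪(extChartAt (𝓡 4) p)⁻¹ y, p⟫ = (4 − ‖y‖²)/(4 + ‖y‖²)`. [folklore] -/
theorem inner_extChartAt_symm (p : Metric.sphere (0 : EuclideanSpace ℝ (Fin 5)) 1)
    (y : EuclideanSpace ℝ (Fin 4)) :
    ⟪(((extChartAt (𝓡 4) p).symm y : Metric.sphere (0 : EuclideanSpace ℝ (Fin 5)) 1) :
        EuclideanSpace ℝ (Fin 5)), (p : EuclideanSpace ℝ (Fin 5))⟫ =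
      (4 - ‖y‖ ^ 2) / (4 + ‖y‖ ^ 2) := by
  -- adapted from Literature/Topology/FourManifolds/CerfPropositionFourInjective.lean
  -- (`inner_stereographic'_symm_neg_pole`)
  have h := Literature.Topology.FourManifolds.real_inner_stereographic'_symm_pole (n := 4) (-p) y
  rw [coe_neg_sphere, inner_neg_right, neg_eq_iff_eq_neg] at h
  rw [extChartAt_symm_eq, h]
  have h4 : (0 : ℝ) < ‖y‖ ^ 2 + 4 := by positivity
  field_simp
  ring

end SphereChart

open SphereChart in
/-- **Witness helper 1 — Mathlib's stereographic chart of `S⁴` at `p`.** For every point `p` of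
the unit sphere `S⁴ ⊂ ℝ⁵`: `extChartAt (𝓡 4) p p = 0`, the chart's target is all of `ℝ⁴`, every
`x ≠ -p` lies in its source, and `⟪(extChartAt (𝓡 4) p)⁻¹ y, p⟫ = (4 − ‖y‖²)/(4 + ‖y‖²)`
(registered form). [folklore] -/
theorem helper_sphereChart :
    ∀ (p : Metric.sphere (0 : EuclideanSpace ℝ (Fin 5)) 1), extChartAt (𝓡 4) p p = 0 ∧ (extChartAt
      (𝓡 4) p).target = univ ∧ (∀ x : Metric.sphere (0 : EuclideanSpace ℝ (Fin 5)) 1, x ≠ -p → x ∈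
      (extChartAt (𝓡 4) p).source) ∧ ∀ y : EuclideanSpace ℝ (Fin 4), ⟪(((extChartAt (𝓡 4) p).symm y
      : Metric.sphere (0 : EuclideanSpace ℝ (Fin 5)) 1) : EuclideanSpace ℝ (Fin 5)), (p :
      EuclideanSpace ℝ (Fin 5))⟫ = (4 - ‖y‖ ^ 2) / (4 + ‖y‖ ^ 2) := by
  intro p
  exact ⟨extChartAt_self p, RoundClauseEuclidean.extChartAt_target_sphere p,
    fun _ hx ↦ mem_extChartAt_source_of_ne p hx, fun y ↦ inner_extChartAt_symm p y⟩

end Summit.SmoothPoincare4.SmoothPoincare4.Theorems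

end
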